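import Summits.CriticalPhenomena.CardyFormulaZ2.Theorems.CardyComplexConeEdgePrecompactUFRSPieces
import Summits.CriticalPhenomena.CardyFormulaZ2.Theorems.CardyComplexConeEdgePrecompactUFRSJunctionBranchDecay
import Summits.CriticalPhenomena.CardyFormulaZ2.Theorems.CardyComplexConeEdgePrecompactUFRSResidualsJ

/-!
# UFRS for one domain from its pieces, J-form: the junction event as the `B`-event
(line `qkz-strip-boundary-arm` of crux `CardyComplexCone.EdgePrecompact`, stmt-CriticalPhenomena-11387;
glue of the corrected road map for the uniform forward response stability "UFRS": module
docstrings of `…UFRSAnnulusCrossings.lean` (correction), `…UFRSEvents.lean` (vocabulary),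
`…UFRSResidualsJ.lean` (the junction event `ufrsJunction`))

`ufrs_of_pieces` (`…UFRSPieces.lean`) derives the UFRS clause at a Dobrushin domain `D` from the
arm domination by `ufrsCert` and the decay of its FAR and MARKED ∪ NEAR branches, by
`ufrs_of_screenedArmDomination` with `A := ufrsCert` and the empty `B`-event. In the J-form of the
arm domination (`ufrs_armDominationJ_of_residuals`, `…UFRSArmDominationJ.lean`) a failure is
certified by `ufrsCert E w z (4η) (ρ/2)` at a collar point OR lies in the junction event
`ufrsJunction E w η ρ` (two-scale junction data at a collar point with a marked edge within `4η`);
this is exactly hypothesis (H₁) of `ufrs_of_screenedArmDomination` with `B := ufrsJunction`, and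
the extra price is hypothesis (H₂'ˢ), the decay of the junction event:

* `ufrs_of_piecesJ` (registered): `ufrs_of_pieces` with the J-form domination and a fourth
  hypothesis, the decay `P(ufrsJunction E w η ρ) ≤ ε` for `η < η₁(ρ, ε)` and fine meshes;
* `ufrs_junctionDecay_rect_of_HJ` (registered): on axis-parallel rectangles that decay follows
  from the junction two-strand decay at the marked edges (the registered bridge
  `ufrs_rect_junctionTwoStrandDecay`, "HJ", taken as a hypothesis) through the union bound
  `ufrs_junctionBranch_le` (`…UFRSJunctionBranchDecay.lean`):
  `P ≤ 4 (log₂⌈ρ/η⌉ + 1) C² (1024 η/ρ)^β`, and `log₂⌈ρ/η⌉ + 1 ≤ (2 + 2/(β log 2)) (ρ/η)^{β/2}`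
  (`log x ≤ x^θ/θ`), so the bound is `O((η/ρ)^{β/2}) → 0` as `η → 0`.

References: G. F. Lawler, O. Schramm, W. Werner, Electron. J. Probab. 7 (2002), Appendix A;
P. Nolin, Electron. J. Probab. 13 (2008), §4 (arm events near boundary points, quasi-
multiplicativity); S. Smirnov, C. R. Acad. Sci. Paris 333 (2001), §2.
-/

namespace Summit.CriticalPhenomena.CardyFormulaZ2.Cruxes.EdgePrecompact.QkzStripBoundaryArm

open MeasureTheory Filter Set Metric
open scoped Topology BigOperators Pointwise
open Literature.Probability.LatticeModels Literature.Probability.Percolation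
open Literature.Probability.RandomPlanarGeometry (DobrushinDomain)
open Summit.CriticalPhenomena.CardyFormulaZ2.Theses.CardyComplexCone

noncomputable section

/-- **UFRS at `D` from the pieces, J-form** (registered sub-goal `ufrs_of_piecesJ` of
stmt-CriticalPhenomena-11387): the J-form arm domination at `D` (certificate `ufrsCert E w z (4η) (ρ/2)`
at a collar point, or the junction event `ufrsJunction E w η ρ`), the decay of the FAR branch, the
decay of the MARKED ∪ NEAR branches and the decay of the junction event give the UFRS clause at
`D` (verbatim the body of `stub_uniformForwardResponseStability` at `D`). Proof: that of
`ufrs_of_pieces` — `ufrs_of_screenedArmDomination` with `A := ufrsCert`, `B := ufrsJunction`, a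
union bound for the branches of `ufrsCert`, and `η₁ ≤ ρ/4096` to switch its escape clause off. -/
theorem ufrs_of_piecesJ : ∀ (D : DobrushinDomain), (∀ (η : ℝ), 0 < η → ∃ δ₀ > (0:ℝ), ∀ E : DiscreteDobrushin, E.Ω = D.carrier → E.IsZdAdmissible → E.δ < δ₀ → ∀ (v w : Site 2) (ρ : ℝ), 4 * η ≤ ρ → 2 * ρ ≤ infDist (meshPoint E.δ v) D.carrierᶜ → ‖meshPoint E.δ w‖ < η → ∀ ω : BondConfig (Site 2), (¬ ∀ a a' : Site 2 × Fin 4, ((E.IsStartCorner a ∧ (shiftData E w).IsStartCorner a') ∨ (a = a' ∧ medialPoint E.δ (cSrc a) ∈ ball (meshPoint E.δ v) ρ ∧ medialPoint E.δ (cTgt a) ∉ ball (meshPoint E.δ v) ρ)) → ∀ n : ℕ, (∀ i < n, medialPoint E.δ (cTgt (cornerOrbit (E.bcBondConfig ω) a i)) ∉ ball (meshPoint E.δ v) ρ ∧ E.IsInnerFace (cFace (cornerOrbit (E.bcBondConfig ω) a (i + 1)))) → medialPoint E.δ (cTgt (cornerOrbit (E.bcBondConfig ω) a n)) ∈ ball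 (meshPoint E.δ v) ρ → ∃ n' : ℕ, (∀ i < n', medialPoint E.δ (cTgt (cornerOrbit ((shiftData E w).bcBondConfig ω) a' i)) ∉ ball (meshPoint E.δ v) ρ ∧ (shiftData E w).IsInnerFace (cFace (cornerOrbit ((shiftData E w).bcBondConfig ω) a' (i + 1)))) ∧ cornerOrbit ((shiftData E w).bcBondConfig ω) a' n' = cornerOrbit (E.bcBondConfig ω) a n ∧ ∑ i ∈ Finset.range n', turnOf ((shiftData E w).bcBondConfig ω) (cornerOrbit ((shiftData E w).bcBondConfig ω) a' i) = ∑ i ∈ Finset.range n, turnOf (E.bcBondConfig ω) (cornerOrbit (E.bcBondConfig ω) a i)) → (∃ z ∈ D.carrier, infDist z D.carrierᶜ < 3 * η ∧ ω ∈ ufrsCert E w z (4 * η) (ρ / 2)) ∨ ω ∈ ufrsJunction E w η ρ) → (∀ ρ > (0:ℝ), ∀ ε > (0:ℝ), ∃ η₁ > (0:ℝ), ∀ η : ℝ, 0 < η → η < η₁ → ∃ δ₀ > (0:ℝ), ∀ E : DiscreteDobrushin, E.Ω = D.carrier → E.IsZdAdmissible → E.δ < δ₀ → ∀ w : Site 2,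 ‖meshPoint E.δ w‖ < η → (bondPercolation (zdGraph 2) half).real {ω : BondConfig (Site 2) | ∃ z ∈ D.carrier, infDist z D.carrierᶜ < 3 * η ∧ ω ∈ ufrsCertFar E w z (4 * η) (ρ / 2)} ≤ ε) → (∀ ρ > (0:ℝ), ∀ ε > (0:ℝ), ∃ η₁ > (0:ℝ), ∀ η : ℝ, 0 < η → η < η₁ → ∃ δ₀ > (0:ℝ), ∀ E : DiscreteDobrushin, E.Ω = D.carrier → E.IsZdAdmissible → E.δ < δ₀ → ∀ w : Site 2, ‖meshPoint E.δ w‖ < η → (bondPercolation (zdGraph 2) half).real {ω : BondConfig (Site 2) | ∃ z ∈ D.carrier, infDist z D.carrierᶜ < 3 * η ∧ ω ∈ ufrsCertMarked E w z (4 * η) (ρ / 2) ∪ ufrsCertNear E w z (4 * η) (ρ / 2)} ≤ ε) → (∀ ρ > (0:ℝ), ∀ ε > (0:ℝ), ∃ η₁ > (0:ℝ), ∀ η : ℝ, 0 < η → η < η₁ → ∃ δ₀ > (0:ℝ), ∀ E : DiscreteDobrushin, E.Ω = D.carrier → E.IsZdAdmissible → E.δ < δ₀ → ∀ w : Site 2,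 ‖meshPoint E.δ w‖ < η → (bondPercolation (zdGraph 2) half).real (ufrsJunction E w η ρ) ≤ ε) → ∀ (K : Set ℂ), IsCompact K → K ⊆ D.carrier → ∀ ρ > (0:ℝ), cthickening (2 * ρ) K ⊆ D.carrier → ∀ ε > (0:ℝ), ∃ η > (0:ℝ), ∃ δ₀ > (0:ℝ), ∀ E : DiscreteDobrushin, E.Ω = D.carrier → E.IsZdAdmissible → E.δ < δ₀ → ∀ v w : Site 2, meshPoint E.δ v ∈ K → ‖meshPoint E.δ w‖ < η → (bondPercolation (zdGraph 2) half).real {ω : BondConfig (Site 2) | ¬ ∀ a a' : Site 2 × Fin 4, ((E.IsStartCorner a ∧ (shiftData E w).IsStartCorner a') ∨ (a = a' ∧ medialPoint E.δ (cSrc a) ∈ ball (meshPoint E.δ v) ρ ∧ medialPoint E.δ (cTgt a) ∉ ball (meshPoint E.δ v) ρ)) → ∀ n : ℕ, (∀ i < n, medialPoint E.δ (cTgt (cornerOrbit (E.bcBondConfig ω) a i)) ∉ ball (meshPoint E.δ v) ρ ∧ E.IsInnerFace (cFace (cornerOrbit (E.bcBondConfig ω) a (i + 1)))) → medialPoint E.δ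 (cTgt (cornerOrbit (E.bcBondConfig ω) a n)) ∈ ball (meshPoint E.δ v) ρ → ∃ n' : ℕ, (∀ i < n', medialPoint E.δ (cTgt (cornerOrbit ((shiftData E w).bcBondConfig ω) a' i)) ∉ ball (meshPoint E.δ v) ρ ∧ (shiftData E w).IsInnerFace (cFace (cornerOrbit ((shiftData E w).bcBondConfig ω) a' (i + 1)))) ∧ cornerOrbit ((shiftData E w).bcBondConfig ω) a' n' = cornerOrbit (E.bcBondConfig ω) a n ∧ ∑ i ∈ Finset.range n', turnOf ((shiftData E w).bcBondConfig ω) (cornerOrbit ((shiftData E w).bcBondConfig ω) a' i) = ∑ i ∈ Finset.range n, turnOf (E.bcBondConfig ω) (cornerOrbit (E.bcBondConfig ω) a i)} ≤ ε := by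
  intro D h1 h2 h3 h4
  refine ufrs_of_screenedArmDomination D (fun E w z r R => ufrsCert E w z r R)
    (fun E w η ρ => ufrsJunction E w η ρ) h1 ?_ h4
  intro ρ hρ ε hε
  obtain ⟨η₂, hη₂, hA⟩ := h2 ρ hρ (ε / 2) (by positivity)
  obtain ⟨η₃, hη₃, hB⟩ := h3 ρ hρ (ε / 2) (by positivity)
  refine ⟨min (min η₂ η₃) (ρ / 4096), lt_min (lt_min hη₂ hη₃) (by positivity), ?_⟩
  intro η hη0 hηlt
  have hη₂' : η < η₂ := lt_of_lt_of_le hηlt ((min_le_left _ _).trans (min_le_left _ _))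
  have hη₃' : η < η₃ := lt_of_lt_of_le hηlt ((min_le_left _ _).trans (min_le_right _ _))
  have hηρ : η < ρ / 4096 := lt_of_lt_of_le hηlt (min_le_right _ _)
  obtain ⟨δ₂, hδ₂, hA'⟩ := hA η hη0 hη₂'
  obtain ⟨δ₃, hδ₃, hB'⟩ := hB η hη0 hη₃'
  refine ⟨min δ₂ δ₃, lt_min hδ₂ hδ₃, ?_⟩
  intro E hEΩ hE hEδ w hw
  have hEδ₂ : E.δ < δ₂ := lt_of_lt_of_le hEδ (min_le_left _ _)
  have hEδ₃ : E.δ < δ₃ := lt_of_lt_of_le hEδ (min_le_right _ _)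
  have key := add_le_add (hA' E hEΩ hE hEδ₂ w hw) (hB' E hEΩ hE hEδ₃ w hw)
  refine le_trans ?_ (le_trans key (by linarith))
  refine le_trans (measureReal_mono ?_) (measureReal_union_le _ _)
  rintro ω ⟨z, hzD, hzc, hcert⟩
  rw [mem_ufrsCert_iff] at hcert
  rcases hcert with ((hesc | hfar) | hmk) | hnear
  · exfalso; linarith
  · exact Or.inl ⟨z, hzD, hzc, hfar⟩
  · exact Or.inr ⟨z, hzD, hzc, Or.inl hmk⟩
  · exact Or.inr ⟨z, hzD, hzc, Or.inr hnear⟩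

/-! ## The decay of the junction event on rectangles, from the junction two-strand decay HJ -/

/-- The number of dyadic scales against a power: for `x ≥ 1` and `θ > 0`,
`log₂⌈x⌉ + 1 ≤ (2 + 1/(θ log 2)) x^θ` (`2^{log₂⌈x⌉} ≤ ⌈x⌉ < x + 1 ≤ 2x`, then
`log x ≤ x^θ/θ` and `1 ≤ x^θ`). -/
theorem logCeil_le_J {x θ : ℝ} (hx : 1 ≤ x) (hθ : 0 < θ) :
    ((Nat.log 2 ⌈x⌉₊ + 1 : ℕ) : ℝ) ≤ (2 + 1 / (θ * Real.log 2)) * x ^ θ := by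
  set n : ℕ := ⌈x⌉₊ with hn
  set L : ℕ := Nat.log 2 n with hL
  have hx0 : 0 < x := by linarith
  have hn0 : n ≠ 0 := (Nat.ceil_pos.2 hx0).ne'
  have h1 : 2 ^ L ≤ n := Nat.pow_log_le_self 2 hn0
  have h2 : (2:ℝ) ^ L ≤ (n : ℝ) := by exact_mod_cast h1
  have h3 : (n : ℝ) < x + 1 := Nat.ceil_lt_add_one hx0.le
  have h4 : (2:ℝ) ^ L ≤ 2 * x := by linarith
  have hlog2 : 0 < Real.log 2 := Real.log_pos one_lt_two
  have h5 : (L : ℝ) * Real.log 2 ≤ Real.log 2 + Real.log x := by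
    have := Real.log_le_log (by positivity) h4
    rwa [Real.log_pow, Real.log_mul (by norm_num) hx0.ne'] at this
  have h6 : (L : ℝ) - 1 ≤ Real.log x / Real.log 2 := by
    rw [le_div_iff₀ hlog2]; linarith
  have h7 : Real.log x ≤ x ^ θ / θ := Real.log_le_rpow_div hx0.le hθ
  have h8 : 1 ≤ x ^ θ := Real.one_le_rpow hx hθ.le
  have h9 : Real.log x / Real.log 2 ≤ (x ^ θ / θ) / Real.log 2 := by gcongr
  have h10 : (x ^ θ / θ) / Real.log 2 = (1 / (θ * Real.log 2)) * x ^ θ := by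
    rw [div_div]; ring
  push_cast
  nlinarith [h6, h9, h10, h8]

/-- The bound of `ufrs_junctionBranch_le` against a power of `η/ρ`: for `0 < η ≤ ρ`, `0 < β`,
`4 (log₂⌈ρ/η⌉ + 1) C² (1024 η/ρ)^β ≤ 4 C² 1024^β (2 + 1/((β/2) log 2)) (η/ρ)^{β/2}`. -/
theorem junctionBound_le_J {η ρ C β : ℝ} (hη : 0 < η) (hηρ : η ≤ ρ) (hβ : 0 < β) :
    4 * ((Nat.log 2 ⌈ρ / η⌉₊ + 1 : ℕ) : ℝ) * C ^ 2 * (1024 * η / ρ) ^ β ≤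
      4 * C ^ 2 * (1024:ℝ) ^ β * (2 + 1 / (β / 2 * Real.log 2)) * (η / ρ) ^ (β / 2) := by
  have hρ : 0 < ρ := lt_of_lt_of_le hη hηρ
  have hx : 1 ≤ ρ / η := by rw [le_div_iff₀ hη]; linarith
  have hu : 0 < η / ρ := by positivity
  have hL := logCeil_le_J hx (half_pos hβ)
  have h1 : (1024 * η / ρ) ^ β = (1024:ℝ) ^ β * ((η / ρ) ^ (β / 2) * (η / ρ) ^ (β / 2)) := by
    rw [mul_div_assoc, Real.mul_rpow (by norm_num) hu.le, ← Real.rpow_add hu, add_halves]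
  have h2 : (ρ / η) ^ (β / 2) * (η / ρ) ^ (β / 2) = 1 := by
    rw [← Real.mul_rpow (by positivity) hu.le, show ρ / η * (η / ρ) = 1 by field_simp, Real.one_rpow]
  have h3 : ((Nat.log 2 ⌈ρ / η⌉₊ + 1 : ℕ) : ℝ) * (η / ρ) ^ (β / 2) ≤ 2 + 1 / (β / 2 * Real.log 2) := by
    calc ((Nat.log 2 ⌈ρ / η⌉₊ + 1 : ℕ) : ℝ) * (η / ρ) ^ (β / 2)
        ≤ (2 + 1 / (β / 2 * Real.log 2)) * (ρ / η) ^ (β / 2) * (η / ρ) ^ (β / 2) :=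
          mul_le_mul_of_nonneg_right hL (by positivity)
      _ = 2 + 1 / (β / 2 * Real.log 2) := by rw [mul_assoc, h2, mul_one]
  have h4 : 0 ≤ 4 * C ^ 2 * (1024:ℝ) ^ β * (η / ρ) ^ (β / 2) := by positivity
  rw [h1]
  calc 4 * ((Nat.log 2 ⌈ρ / η⌉₊ + 1 : ℕ) : ℝ) * C ^ 2 * ((1024:ℝ) ^ β * ((η / ρ) ^ (β / 2) * (η / ρ) ^ (β / 2)))
      = (4 * C ^ 2 * (1024:ℝ) ^ β * (η / ρ) ^ (β / 2)) * (((Nat.log 2 ⌈ρ / η⌉₊ + 1 : ℕ) : ℝ) * (η / ρ) ^ (β / 2)) := by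
        ring
    _ ≤ (4 * C ^ 2 * (1024:ℝ) ^ β * (η / ρ) ^ (β / 2)) * (2 + 1 / (β / 2 * Real.log 2)) :=
        mul_le_mul_of_nonneg_left h3 h4
    _ = 4 * C ^ 2 * (1024:ℝ) ^ β * (2 + 1 / (β / 2 * Real.log 2)) * (η / ρ) ^ (β / 2) := by ring

/-- The collar threshold: for `ρ, ε > 0`, `β > 0` there is `η₁ ∈ (0, ρ/4096]` with
`4 (log₂⌈ρ/η⌉ + 1) C² (1024 η/ρ)^β ≤ ε` for all `η ∈ (0, η₁)`. -/
theorem junctionThreshold_J {ρ ε β : ℝ} (C : ℝ) (hρ : 0 < ρ) (hε : 0 < ε) (hβ : 0 < β) :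
    ∃ η₁ : ℝ, 0 < η₁ ∧ η₁ ≤ ρ / 4096 ∧ ∀ η : ℝ, 0 < η → η < η₁ →
      4 * ((Nat.log 2 ⌈ρ / η⌉₊ + 1 : ℕ) : ℝ) * C ^ 2 * (1024 * η / ρ) ^ β ≤ ε := by
  have hlog2 : 0 < Real.log 2 := Real.log_pos one_lt_two
  set M : ℝ := 4 * C ^ 2 * (1024:ℝ) ^ β * (2 + 1 / (β / 2 * Real.log 2)) + 1 with hM
  have hK : 0 < 2 + 1 / (β / 2 * Real.log 2) := by positivity
  have hM1 : 4 * C ^ 2 * (1024:ℝ) ^ β * (2 + 1 / (β / 2 * Real.log 2)) ≤ M := by rw [hM]; linarith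
  have hM0 : 0 < M := by
    have : 0 ≤ 4 * C ^ 2 * (1024:ℝ) ^ β * (2 + 1 / (β / 2 * Real.log 2)) := by positivity
    rw [hM]; linarith
  have hεM : 0 < ε / M := div_pos hε hM0
  set t : ℝ := (ε / M) ^ (1 / (β / 2)) with ht
  have ht0 : 0 < t := Real.rpow_pos_of_pos hεM _
  refine ⟨min (ρ / 4096) (ρ * t), lt_min (by positivity) (mul_pos hρ ht0), min_le_left _ _, ?_⟩
  intro η hη hηlt
  have hη1 : η < ρ / 4096 := lt_of_lt_of_le hηlt (min_le_left _ _)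
  have hη2 : η < ρ * t := lt_of_lt_of_le hηlt (min_le_right _ _)
  have hηρ : η ≤ ρ := by linarith
  have hηt : η / ρ < t := by rw [div_lt_iff₀ hρ]; linarith
  have h1 := junctionBound_le_J (C := C) hη hηρ hβ
  have h2 : (η / ρ) ^ (β / 2) < ε / M := by
    calc (η / ρ) ^ (β / 2) < t ^ (β / 2) := Real.rpow_lt_rpow (by positivity) hηt (half_pos hβ)
      _ = ε / M := by rw [ht, ← Real.rpow_mul hεM.le, one_div_mul_cancel (half_pos hβ).ne', Real.rpow_one]
  calc 4 * ((Nat.log 2 ⌈ρ / η⌉₊ + 1 : ℕ) : ℝ) * C ^ 2 * (1024 * η / ρ) ^ β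
      ≤ 4 * C ^ 2 * (1024:ℝ) ^ β * (2 + 1 / (β / 2 * Real.log 2)) * (η / ρ) ^ (β / 2) := h1
    _ ≤ M * (η / ρ) ^ (β / 2) := mul_le_mul_of_nonneg_right hM1 (by positivity)
    _ ≤ M * (ε / M) := mul_le_mul_of_nonneg_left h2.le hM0.le
    _ = ε := by field_simp

/-- **Decay of the junction event on rectangles, from HJ** (registered sub-goal
`ufrs_junctionDecay_rect_of_HJ` of stmt-CriticalPhenomena-11387). HYPOTHESIS: the registered bridge
`ufrs_rect_junctionTwoStrandDecay` verbatim (junction two-strand decay `C (s/S)^β` at the marked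
edges of `E` and of `shiftData E w`, for rectangles). CONCLUSION: for an axis-parallel rectangle
`D` and `ρ, ε > 0` there is `η₁ > 0` such that for `0 < η < η₁` and fine admissible data of `D` with
shift `‖E.δ w‖ < η`, the junction event (written out: `ufrsJunction E w η ρ` unfolded, with
`Ω = E.Ω`) has probability `≤ ε`. Proof: `ufrs_junctionBranch_le` with `Ω := E.Ω` and the HJ bound
at scale `η` (mesh threshold `min δ₀ η`, so that `E.δ ≤ η`), then `junctionThreshold_J`. -/
theorem ufrs_junctionDecay_rect_of_HJ : (∀ (D : DobrushinDomain), (∃ x₀ x₁ y₀ y₁ : ℝ, x₀ < x₁ ∧ y₀ < y₁ ∧ D.carrier = Set.Ioo x₀ x₁ ×ℂ Set.Ioo y₀ y₁) → ∃ C β : ℝ, 0 < C ∧ 0 < β ∧ ∃ η₀ > (0:ℝ), ∀ η : ℝ, 0 < η → η < η₀ → ∃ δ₀ > (0:ℝ), ∀ E : DiscreteDobrushin, E.Ω = D.carrier → E.IsZdAdmissible → E.δ < δ₀ → ∀ w : Site 2, ‖meshPoint E.δ w‖ < η → ∀ e₀ : Sym2 (Site 2), (e₀ ∈ E.zdABEdges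 ∨ e₀ ∈ (shiftData E w).zdABEdges) → ∀ s S : ℝ, η ≤ s → 0 < S → (bondPercolation (zdGraph 2) half).real (ufrsStrands E w (medialPoint E.δ e₀) 2 s S) ≤ C * (s / S) ^ β) → ∀ (D : DobrushinDomain), (∃ x₀ x₁ y₀ y₁ : ℝ, x₀ < x₁ ∧ y₀ < y₁ ∧ D.carrier = Set.Ioo x₀ x₁ ×ℂ Set.Ioo y₀ y₁) → ∀ ρ > (0:ℝ), ∀ ε > (0:ℝ), ∃ η₁ > (0:ℝ), ∀ η : ℝ, 0 < η → η < η₁ → ∃ δ₀ > (0:ℝ), ∀ E : DiscreteDobrushin, E.Ω = D.carrier → E.IsZdAdmissible → E.δ < δ₀ → ∀ w : Site 2, ‖meshPoint E.δ w‖ < η → (bondPercolation (zdGraph 2) half).real {ω : BondConfig (Site 2) | ∃ z ∈ E.Ω, infDist z E.Ωᶜ < 3 * η ∧ z ∈ ufrsMarkedNbhd E w (4 * η) ∧ ∃ R' : ℝ, (∃ k : ℕ, R' = ρ / 2 / 2 / 2 ^ (k + 1)) ∧ 32 * (4 * η) ≤ R' ∧ ω ∈ ufrsStrands E w z 2 (4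 * η) R' ∧ ω ∈ ufrsStrands E w z 2 (4 * R') (ρ / 2 / 2)} ≤ ε := by
  intro hHJ D hrect ρ hρ ε hε
  obtain ⟨C, β, hC, hβ, η₀, hη₀, hJ⟩ := hHJ D hrect
  obtain ⟨η₁, hη₁, hη₁ρ, hbound⟩ := junctionThreshold_J C hρ hε hβ
  refine ⟨min η₁ η₀, lt_min hη₁ hη₀, ?_⟩
  intro η hη hηlt
  have hη₁' : η < η₁ := lt_of_lt_of_le hηlt (min_le_left _ _)
  have hη₀' : η < η₀ := lt_of_lt_of_le hηlt (min_le_right _ _)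
  obtain ⟨δ₀, hδ₀, hJ'⟩ := hJ η hη hη₀'
  refine ⟨min δ₀ η, lt_min hδ₀ hη, ?_⟩
  intro E hEΩ hE hEδ w hw
  have hEδ₀ : E.δ < δ₀ := lt_of_lt_of_le hEδ (min_le_left _ _)
  have hδη : E.δ ≤ η := (lt_of_lt_of_le hEδ (min_le_right _ _)).le
  have key := ufrs_junctionBranch_le E w η ρ C β hE hδη hη (by linarith) hC.le hβ (hJ' E hEΩ hE hEδ₀ w hw) E.Ω
  exact key.trans (hbound η hη hη₁')

end

end Summit.CriticalPhenomena.CardyFormulaZ2.Cruxes.EdgePrecompact.QkzStripBoundaryArm
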